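import Summits.QuantumFields.YangMills.Theorems.ConvexGribovBodyCovarianceBoundStubTwistGapMeasurable
import Summits.QuantumFields.YangMills.Theorems.ConvexGribovBodyCovarianceBoundStubSupportLie
import Summits.QuantumFields.YangMills.Theorems.ConvexGribovBodyCovarianceBoundStubLieAlgPerfect
import Mathlib.Algebra.QuadraticDiscriminant
import HarnessLib

/-!
# Stub `stub_coneInequality` for the crux `CovarianceBound` (stmt-QuantumFields-8780), line `Sketch`
# (ideator 4: twist-stiffness envelope)

Route `QuantumFields/YangMills/ConvexGribovBody`, crux
`Summit.QuantumFields.YangMills.Theses.ConvexGribovBody.CovarianceBound`, skeleton `Cruxes/CovarianceBound/Lines/Sketch.lean`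
(continuation lead c4). This file proves the registered DETERMINISTIC stub `stub_coneInequality`: at an absolute minimiser
`h` of the slice Coulomb functional and for every one-parameter generator `X ∈ r.lieAlgCarrier` of `ρ(G)`,

  `zeroModePair r S j U h X ^ 2 ≤ 2 · ((2S+1)³ · ‖X‖²_F) · twistGap r S j U`,

the first quantitative use of ABSOLUTE minimality at zero momentum on this crux (the spread toron of
`Negative.ToronTight` is its equality case up to constants).

Proof.
* BOOST = TWIST (`twistMin_le_boosted`): boosting every time-zero link of direction `j+1` by `exp(tX)` on the right is the
  effect of the quasi-periodic gauge transformation `k(x) = g(-t·x_{j+1}) h(x)` (`ρ(g(s)) = exp(sX)`, a lift through the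
  faithful `ρ`) with the twist `g(t(2S+1))` on the seam links, so `twistMin ≤ boostedCoulombF … (exp(t • X))` for all
  real `t`, while `boostedCoulombF … 1 = coulombF … h = perMin` at a minimiser.
* TAYLOR (`re_trace_mul_exp_ge`): for unitary `W` and `X` generating a unitary one-parameter group,
  `Re tr(W e^{tX}) ≥ Re tr W + t Re tr(W X) − t² ‖X‖²_F / 2` (the second derivative `Re tr(W e^{uX} X²)` is bounded by
  `‖X‖²_F` by Cauchy–Schwarz and unitary invariance of the Frobenius norm; a function with `f'' ≥ −M` lies above its
  tangent parabola). Summed over the `(2S+1)³` links of direction `j+1`: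
  `boostedCoulombF(e^{tX}) ≤ perMin + t · zeroModePair + (2S+1)³ ‖X‖²_F t²/2` (`Re tr(A_j(y) X) = Re tr(V X)` for skew `X`).
* Hence `0 ≤ ((2S+1)³‖X‖²_F/2) t² + zeroModePair · t + twistGap` for all `t`; the discriminant bound concludes.

Helper lemmas live in the sub-namespace `ConeInequality`. No named facts are used.
References: idea card `Cruxes/CovarianceBound/Ideas/twist-stiffness-envelope.md`; D. Zwanziger, Nucl. Phys. B 412 (1994)
657, §2 (minimal Coulomb gauge, winding comparison).
-/

set_option autoImplicit false

noncomputable section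

namespace Summit.QuantumFields.YangMills.Cruxes.CovarianceBound.TwistStiffness

open scoped BigOperators Matrix ComplexConjugate
open NormedSpace
open MeasureTheory Literature.MathematicalPhysics.QuantumFieldTheory
open Summit.QuantumFields.YangMills.Cruxes.CovarianceBound.SupportWindow

namespace ConeInequality

/-! ### Real analysis: a function with `f'' ≥ -M` lies above its tangent parabola -/

/-- If `f` is twice differentiable on `ℝ` with `f'' ≥ -M`, then `f t ≥ f 0 + t f'(0) - M t²/2` for every real `t`.
[folklore] -/
theorem taylor_lower {f f' f'' : ℝ → ℝ} (hf : ∀ x, HasDerivAt f (f' x) x)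
    (hf' : ∀ x, HasDerivAt f' (f'' x) x) {M : ℝ} (hM : ∀ x, -M ≤ f'' x) (t : ℝ) :
    f 0 + t * f' 0 - M * t ^ 2 / 2 ≤ f t := by
  -- `g x = f x - f 0 - x f'(0) + M x²/2` has `g 0 = 0`, `g' 0 = 0`, `g'' ≥ 0`
  set g : ℝ → ℝ := fun x => f x - f 0 - x * f' 0 + M * x ^ 2 / 2 with hg
  set g' : ℝ → ℝ := fun x => f' x - f' 0 + M * x with hg'
  have hgd : ∀ x, HasDerivAt g (g' x) x := fun x => by
    have h1 : HasDerivAt (fun y : ℝ => y * f' 0) (1 * f' 0) x := (hasDerivAt_id x).mul_const _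
    have h2 : HasDerivAt (fun y : ℝ => M * y ^ 2 / 2) (M * (2 * x ^ 1 * 1) / 2) x :=
      (((hasDerivAt_id x).pow 2).const_mul M).div_const 2
    have h := (((hf x).sub_const (f 0)).sub h1).add h2
    refine h.congr_deriv ?_
    simp only [hg', pow_one, one_mul, mul_one]
    ring
  have hg'd : ∀ x, HasDerivAt g' (f'' x + M) x := fun x => by
    have h := ((hf' x).sub_const (f' 0)).add ((hasDerivAt_id x).const_mul M)
    refine h.congr_deriv ?_
    simp only [mul_one]
  have hmono : Monotone g' :=
    monotone_of_hasDerivAt_nonneg hg'd fun x => by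
      have := hM x
      show 0 ≤ f'' x + M
      linarith
  have hg'0 : g' 0 = 0 := by simp only [hg', sub_self, mul_zero, add_zero]
  have hg0 : g 0 = 0 := by simp [hg]
  have hcont : Continuous g := continuous_iff_continuousAt.2 fun x => (hgd x).continuousAt
  have hderiv : ∀ x, deriv g x = g' x := fun x => (hgd x).deriv
  have hdiff : Differentiable ℝ g := fun x => (hgd x).differentiableAt
  have hgt : 0 ≤ g t := by
    rcases le_total 0 t with ht | ht
    · have hm : MonotoneOn g (Set.Ici 0) :=
        monotoneOn_of_deriv_nonneg (convex_Ici 0) hcont.continuousOn hdiff.differentiableOn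
          fun x hx => by
            rw [interior_Ici] at hx
            rw [hderiv, ← hg'0]
            exact hmono (le_of_lt hx)
      simpa only [hg0] using hm (Set.mem_Ici.2 le_rfl) (Set.mem_Ici.2 ht) ht
    · have hm : AntitoneOn g (Set.Iic 0) :=
        antitoneOn_of_deriv_nonpos (convex_Iic 0) hcont.continuousOn hdiff.differentiableOn
          fun x hx => by
            rw [interior_Iic] at hx
            rw [hderiv, ← hg'0]
            exact hmono (le_of_lt hx)
      simpa only [hg0] using hm (Set.mem_Iic.2 ht) (Set.mem_Iic.2 le_rfl) ht
  have : g t = f t - f 0 - t * f' 0 + M * t ^ 2 / 2 := rfl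
  linarith

/-! ### Matrix analysis: second-order expansion of `Re tr(W e^{tX})` -/

section MatrixAnalysis

variable {N : ℕ}

set_option backward.isDefEq.respectTransparency false in
open scoped Matrix.Norms.Frobenius in
/-- `d/du Re tr(W e^{uX}) = Re tr(W e^{uX} X)`. [folklore] -/
theorem hasDerivAt_re_trace_mul_exp (W X : Matrix (Fin N) (Fin N) ℂ) (u : ℝ) :
    HasDerivAt (fun v : ℝ => (W * exp (v • X)).trace.re) ((W * exp (u • X) * X).trace.re) u := by
  have h1 : HasDerivAt (fun v : ℝ => exp (v • X)) (exp (u • X) * X) u :=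
    hasDerivAt_exp_smul_const (𝕂 := ℝ) X u
  have h2 : HasDerivAt (fun v : ℝ => W * exp (v • X)) (W * (exp (u • X) * X)) u := h1.const_mul W
  set L : Matrix (Fin N) (Fin N) ℂ →L[ℝ] ℂ :=
    LinearMap.toContinuousLinearMap ((Matrix.traceLinearMap (Fin N) ℂ ℂ).restrictScalars ℝ) with hL
  have hLapply : ∀ M : Matrix (Fin N) (Fin N) ℂ, L M = M.trace := fun M => rfl
  have h3 := Complex.reCLM.hasFDerivAt.comp_hasDerivAt u (L.hasFDerivAt.comp_hasDerivAt u h2)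
  have h4 : HasDerivAt (fun v : ℝ => (W * exp (v • X)).trace.re)
      (Complex.reCLM (L (W * (exp (u • X) * X)))) u := h3
  refine h4.congr_deriv ?_
  rw [Complex.reCLM_apply, hLapply, mul_assoc]

/-- `|Re tr(W X X)| ≤ ‖X‖²_F` for unitary `W` (Cauchy–Schwarz and `‖W X‖_F = ‖X‖_F`). [folklore] -/
theorem abs_re_trace_unitary_mul_mul_le {W : Matrix (Fin N) (Fin N) ℂ}
    (hW : W ∈ Matrix.unitaryGroup (Fin N) ℂ) (X : Matrix (Fin N) (Fin N) ℂ) :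
    |(W * X * X).trace.re| ≤ frobNorm X ^ 2 := by
  calc |(W * X * X).trace.re| ≤ frobNorm (W * X) * frobNorm X := abs_re_trace_mul_le _ _
    _ = frobNorm X ^ 2 := by rw [frobNorm_unitary_mul hW, sq]

/-- `‖X‖²_F = froSq X`. [folklore] -/
theorem frobNorm_sq_eq_froSq (X : Matrix (Fin N) (Fin N) ℂ) : frobNorm X ^ 2 = froSq X := by
  rw [frobNorm_sq]; rfl

/-- **Second-order expansion of the gauge functional along a boost.** For unitary `W` and a generator `X` of a unitary
one-parameter group, `Re tr(W e^{tX}) ≥ Re tr W + t Re tr(W X) - t² ‖X‖²_F / 2` for every real `t`. [folklore] -/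
theorem re_trace_mul_exp_ge {W X : Matrix (Fin N) (Fin N) ℂ} (hW : W ∈ Matrix.unitaryGroup (Fin N) ℂ)
    (hX : ∀ s : ℝ, exp (s • X) ∈ Matrix.unitaryGroup (Fin N) ℂ) (t : ℝ) :
    W.trace.re + t * (W * X).trace.re - froSq X * t ^ 2 / 2 ≤ (W * exp (t • X)).trace.re := by
  have hcomm : ∀ v : ℝ, exp (v • X) * X = X * exp (v • X) := fun v =>
    (((Commute.refl X).smul_left v).exp_left).eq
  -- first and second derivatives of `f v = Re tr(W e^{vX})`
  have hf : ∀ v, HasDerivAt (fun v : ℝ => (W * exp (v • X)).trace.re)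
      ((W * X * exp (v • X)).trace.re) v := fun v => by
    have h := hasDerivAt_re_trace_mul_exp W X v
    rwa [mul_assoc, hcomm, ← mul_assoc] at h
  have hf' : ∀ v, HasDerivAt (fun v : ℝ => (W * X * exp (v • X)).trace.re)
      ((W * X * exp (v • X) * X).trace.re) v := fun v => hasDerivAt_re_trace_mul_exp (W * X) X v
  have hM : ∀ v, -froSq X ≤ (W * X * exp (v • X) * X).trace.re := fun v => by
    have hu : W * exp (v • X) ∈ Matrix.unitaryGroup (Fin N) ℂ := Submonoid.mul_mem _ hW (hX v)
    have h := abs_re_trace_unitary_mul_mul_le hu X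
    rw [frobNorm_sq_eq_froSq] at h
    have h' : W * X * exp (v • X) * X = W * exp (v • X) * X * X := by
      rw [mul_assoc W X, ← hcomm, ← mul_assoc]
    rw [h']
    exact (abs_le.1 h).1
  have h := taylor_lower hf hf' hM t
  simp only [zero_smul, exp_zero, mul_one] at h
  linarith

/-- Cyclicity: `tr(e^{aX} V e^{bX} e^{cX}) = tr(V e^{(b+c+a)X})`. [folklore] -/
theorem trace_exp_conj_mul_exp (V X : Matrix (Fin N) (Fin N) ℂ) (a b c : ℝ) :
    (exp (a • X) * V * exp (b • X) * exp (c • X)).trace = (V * exp ((b + c + a) • X)).trace := by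
  rw [mul_assoc (exp (a • X) * V), Matrix.trace_mul_comm (exp (a • X) * V), ← mul_assoc,
    Matrix.trace_mul_comm _ V]
  congr 1
  rw [LiePerfect.exp_smul_mul_exp_smul, LiePerfect.exp_smul_mul_exp_smul]

/-- Cyclicity: `tr(e^{aX} V e^{bX}) = tr(V e^{(b+a)X})`. [folklore] -/
theorem trace_exp_conj (V X : Matrix (Fin N) (Fin N) ℂ) (a b : ℝ) :
    (exp (a • X) * V * exp (b • X)).trace = (V * exp ((b + a) • X)).trace := by
  rw [mul_assoc, Matrix.trace_mul_comm, mul_assoc, LiePerfect.exp_smul_mul_exp_smul]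

end MatrixAnalysis

/-! ### Lattice bookkeeping: coordinates along the boosted direction -/

section Lattice

variable {G : Type} [Group G] [TopologicalSpace G]

/-- Shifting in direction `i` does not change the other coordinates. [folklore] -/
theorem shift_apply_of_ne {L : ℕ} (x : Site 4 L) {i k : Fin 4} (hk : k ≠ i) : (x.shift i) k = x k := by
  simp only [Site.shift, Pi.add_apply, Pi.single_apply, if_neg hk, add_zero]

/-- Shifting in direction `i` adds one to the `i`-th coordinate. [folklore] -/
theorem shift_apply_self {L : ℕ} (x : Site 4 L) (i : Fin 4) : (x.shift i) i = x i + 1 := by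
  simp only [Site.shift, Pi.add_apply, Pi.single_eq_same]

/-- Away from the seam the coordinate value increases by one. [folklore] -/
theorem val_add_one_of_ne (S : ℕ) (a : ZMod (2 * S + 1)) (ha : a.val ≠ 2 * S) :
    ((a + 1).val : ℝ) = a.val + 1 := by
  have hlt : a.val < 2 * S + 1 := a.val_lt
  obtain _ | S := S
  · exfalso; omega
  · have h1 : (1 : ZMod (2 * (S + 1) + 1)).val = 1 := by
      rw [ZMod.val_one_eq_one_mod]; exact Nat.mod_eq_of_lt (by omega)
    rw [ZMod.val_add, h1, Nat.mod_eq_of_lt (by omega)]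
    push_cast
    ring

/-- Across the seam the coordinate value wraps to zero. [folklore] -/
theorem val_add_one_of_eq (S : ℕ) (a : ZMod (2 * S + 1)) (ha : a.val = 2 * S) : (a + 1).val = 0 := by
  obtain _ | S := S
  · exact Nat.lt_one_iff.1 (ZMod.val_lt (a + 1))
  · have h1 : (1 : ZMod (2 * (S + 1) + 1)).val = 1 := by
      rw [ZMod.val_one_eq_one_mod]; exact Nat.mod_eq_of_lt (by omega)
    rw [ZMod.val_add, h1, ha, Nat.mod_self]

/-! ### The boosted functional: as a slice sum, and its second-order expansion -/

/-- The boosted slice functional as a sum over `(y, j') ↦` the spatial link `((0,y), j'+1)`. [folklore] -/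
theorem boostedCoulombF_eq (r : LatticeRep G) (S : ℕ) (j : Fin 3) (U : GaugeConfig 4 (2 * S + 1) G)
    (k : Site 4 (2 * S + 1) → G) (B : Matrix (Fin r.N) (Fin r.N) ℂ) :
    boostedCoulombF r S j U k B = -∑ q : (Fin 3 → ZMod (2 * S + 1)) × Fin 3,
      (r.ρ (gaugeTransform k U (Fin.cons 0 q.1, q.2.succ)) * (if q.2 = j then B else 1)).trace.re := by
  unfold boostedCoulombF
  rw [CoulombFP.sum_edge_slice_eq]
  simp only [Fin.succ_inj]

/-- `boosted(B) - coul = -Σ_y (Re tr(V_{y,j} B) - Re tr V_{y,j})`: only the links of direction `j+1` change. [folklore] -/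
theorem boostedCoulombF_sub_coulombF (r : LatticeRep G) (S : ℕ) (j : Fin 3) (U : GaugeConfig 4 (2 * S + 1) G)
    (k : Site 4 (2 * S + 1) → G) (B : Matrix (Fin r.N) (Fin r.N) ℂ) :
    boostedCoulombF r S j U k B - coulombF r S U k =
      -∑ y : Fin 3 → ZMod (2 * S + 1),
        ((r.ρ (gaugeTransform k U (Fin.cons 0 y, j.succ)) * B).trace.re -
          (r.ρ (gaugeTransform k U (Fin.cons 0 y, j.succ))).trace.re) := by
  rw [boostedCoulombF_eq, SupportLie.coulombF_eq, neg_sub_neg, Fintype.sum_prod_type, Fintype.sum_prod_type,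
    ← Finset.sum_sub_distrib, ← Finset.sum_neg_distrib]
  refine Finset.sum_congr rfl fun y _ => ?_
  rw [← Finset.sum_sub_distrib, Finset.sum_eq_single j]
  · rw [if_pos rfl]; ring
  · intro j' _ hj'
    rw [if_neg hj', mul_one, sub_self]
  · intro h; exact absurd (Finset.mem_univ j) h

/-- `Σ_y Re tr(V_{y,j} X) = -zeroModePair` for skew-Hermitian `X` (`Re tr(A_j(y) X) = Re tr(V_{y,j} X)`). [folklore] -/
theorem sum_re_trace_mul_eq_neg_zeroModePair (r : LatticeRep G) (S : ℕ) (j : Fin 3)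
    (U : GaugeConfig 4 (2 * S + 1) G) (h : Site 4 (2 * S + 1) → G) {X : Matrix (Fin r.N) (Fin r.N) ℂ}
    (hX : Xᴴ = -X) :
    ∑ y : Fin 3 → ZMod (2 * S + 1), (r.ρ (gaugeTransform h U (Fin.cons 0 y, j.succ)) * X).trace.re =
      -zeroModePair r S j U h X := by
  unfold zeroModePair
  rw [neg_neg, Finset.sum_mul, Matrix.trace_sum, Complex.re_sum]
  refine Finset.sum_congr rfl fun y _ => ?_
  exact (SupportLie.re_trace_half_sub_mul _ X hX).symm

/-- **Second-order expansion of the boosted functional**: for a generator `X` of a unitary one-parameter group,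
`boosted(e^{tX}) ≤ coul(k) - t Σ_y Re tr(V_{y,j} X) + (2S+1)³ ‖X‖²_F t²/2`. [folklore] -/
theorem boostedCoulombF_exp_le (r : LatticeRep G) (S : ℕ) (j : Fin 3) (U : GaugeConfig 4 (2 * S + 1) G)
    (k : Site 4 (2 * S + 1) → G) {X : Matrix (Fin r.N) (Fin r.N) ℂ}
    (hXu : ∀ s : ℝ, exp (s • X) ∈ Matrix.unitaryGroup (Fin r.N) ℂ) (t : ℝ) :
    boostedCoulombF r S j U k (exp (t • X)) ≤ coulombF r S U k -
      t * ∑ y : Fin 3 → ZMod (2 * S + 1), (r.ρ (gaugeTransform k U (Fin.cons 0 y, j.succ)) * X).trace.re +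
      (2 * S + 1 : ℝ) ^ 3 * froSq X * t ^ 2 / 2 := by
  have hsub := boostedCoulombF_sub_coulombF r S j U k (exp (t • X))
  have hle : ∑ y : Fin 3 → ZMod (2 * S + 1),
      (t * (r.ρ (gaugeTransform k U (Fin.cons 0 y, j.succ)) * X).trace.re - froSq X * t ^ 2 / 2) ≤
      ∑ y : Fin 3 → ZMod (2 * S + 1),
        ((r.ρ (gaugeTransform k U (Fin.cons 0 y, j.succ)) * exp (t • X)).trace.re -
          (r.ρ (gaugeTransform k U (Fin.cons 0 y, j.succ))).trace.re) :=
    Finset.sum_le_sum fun y _ => by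
      have := re_trace_mul_exp_ge (r.mem_unitary (gaugeTransform k U (Fin.cons 0 y, j.succ))) hXu t
      linarith
  rw [Finset.sum_sub_distrib, ← Finset.mul_sum, Finset.sum_const, Finset.card_univ, nsmul_eq_mul,
    SupMeasurable.card_slice] at hle
  linarith

/-! ### Boost = twist: absolute minimality over twisted transformations bounds the boosted functional -/

/-- **The boosted functional is a twisted functional.** With `ρ(g(s)) = exp(sX)`, the gauge transformation
`k(x) = g(-t·x_{j+1}) h(x)` and the twist `g(t(2S+1))` on the seam links reproduce the boost by `exp(tX)` on every
link of direction `j+1`. [folklore] -/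
theorem twistedCoulombF_lift_eq (r : LatticeRep G) (S : ℕ) (j : Fin 3) (U : GaugeConfig 4 (2 * S + 1) G)
    (h : Site 4 (2 * S + 1) → G) {X : Matrix (Fin r.N) (Fin r.N) ℂ} {g : ℝ → G}
    (hg : ∀ s : ℝ, r.ρ (g s) = exp (s • X)) (t : ℝ) :
    twistedCoulombF r S j U (fun x => g (-(t * ((x j.succ).val : ℝ))) * h x) (g (t * (2 * S + 1 : ℝ))) =
      boostedCoulombF r S j U h (exp (t • X)) := by
  unfold twistedCoulombF boostedCoulombF
  congr 1
  refine Finset.sum_congr rfl fun e _ => ?_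
  obtain ⟨x, i⟩ := e
  by_cases he : x 0 = 0 ∧ i ≠ 0
  · rw [if_pos he, if_pos he]
    have hW : gaugeTransform (fun x => g (-(t * ((x j.succ).val : ℝ))) * h x) U (x, i) =
        g (-(t * ((x j.succ).val : ℝ))) * gaugeTransform h U (x, i) *
          (g (-(t * (((Site.shift x i) j.succ).val : ℝ))))⁻¹ := by
      simp only [gaugeTransform, mul_inv_rev, mul_assoc]
    by_cases hi : i = j.succ
    · subst hi
      rw [if_pos rfl]
      by_cases hn : (x j.succ).val = 2 * S
      · -- seam link: twist `g(t(2S+1))`, shifted coordinate value `0`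
        rw [if_pos ⟨rfl, hn⟩, hW, map_mul, map_mul, map_mul, hg, ← SupportLie.lift_neg r hg, hg, hg,
          shift_apply_self, val_add_one_of_eq S _ hn, hn, trace_exp_conj_mul_exp]
        congr 4
        push_cast
        ring
      · -- interior link: no twist, shifted coordinate value `+1`
        rw [if_neg (fun h' => hn h'.2), mul_one, hW, map_mul, map_mul, hg, ← SupportLie.lift_neg r hg, hg,
          shift_apply_self, val_add_one_of_ne S _ hn, trace_exp_conj]
        congr 4
        ring
    · -- transverse link: conjugation by the same group element
      rw [if_neg (fun h' => hi h'.1), if_neg hi, mul_one, mul_one, hW, map_mul, map_mul, hg,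
        ← SupportLie.lift_neg r hg, hg, shift_apply_of_ne x (Ne.symm hi), trace_exp_conj, neg_neg,
        add_neg_cancel, zero_smul, exp_zero, mul_one]
  · rw [if_neg he, if_neg he]

/-- **Absolute minimality over twisted transformations**: `twistMin ≤ boosted(e^{tX})` for every real `t` and every
one-parameter generator `X ∈ 𝔤`. [folklore] -/
theorem twistMin_le_boosted (r : LatticeRep G) (S : ℕ) (j : Fin 3) (U : GaugeConfig 4 (2 * S + 1) G)
    (h : Site 4 (2 * S + 1) → G) {X : Matrix (Fin r.N) (Fin r.N) ℂ} (hX : X ∈ r.lieAlgCarrier) (t : ℝ) :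
    twistMin r S j U ≤ boostedCoulombF r S j U h (exp (t • X)) := by
  choose g hg using hX.2
  rw [← twistedCoulombF_lift_eq r S j U h hg t]
  exact ciInf_le (TwistGapMeasurable.bddBelow_range_twistedCoulombF r S j U)
    (g (t * (2 * S + 1 : ℝ)), fun x => g (-(t * ((x j.succ).val : ℝ))) * h x)

/-- At an absolute minimiser the periodic minimum is attained: `perMin = coul(h)`. [folklore] -/
theorem perMin_eq_of_isCoulMin (r : LatticeRep G) (S : ℕ) (U : GaugeConfig 4 (2 * S + 1) G)
    (h : Site 4 (2 * S + 1) → G) (hmin : IsCoulMin r S U h) : perMin r S U = coulombF r S U h :=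
  le_antisymm (ciInf_le (TwistGapMeasurable.bddBelow_range_coulombF r S U) h) (le_ciInf hmin)

end Lattice

end ConeInequality

variable {G : Type} [Group G] [TopologicalSpace G]

open ConeInequality in
/-- **Stub 1 of line `Sketch` — the cone inequality.** At an absolute Coulomb minimiser `h`, for every one-parameter
generator `X` of `ρ(G)`: `zeroModePair² ≤ 2 · ((2S+1)³ ‖X‖²_F) · twistGap`. The twist-energy class function has a cone
at the trivial twist whose slope is the zero mode; a semiconcave function that stays above `twistMin` cannot dip below
`perMin − twistGap`. [folklore] -/
theorem stub_coneInequality (r : LatticeRep G) (S : ℕ) (j : Fin 3)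
    (X : Matrix (Fin r.N) (Fin r.N) ℂ) (hX : X ∈ r.lieAlgCarrier)
    (U : GaugeConfig 4 (2 * S + 1) G) (h : Site 4 (2 * S + 1) → G) (hmin : IsCoulMin r S U h) :
    (zeroModePair r S j U h X) ^ 2 ≤ 2 * ((2 * S + 1 : ℝ) ^ 3 * froSq X) * twistGap r S j U := by
  have hskew : Xᴴ = -X := by rw [← Matrix.star_eq_conjTranspose]; exact hX.1
  have hXu : ∀ s : ℝ, exp (s • X) ∈ Matrix.unitaryGroup (Fin r.N) ℂ := fun s => by
    obtain ⟨g, hg⟩ := hX.2 s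
    rw [← hg]
    exact r.mem_unitary g
  set T : ℝ := ∑ y : Fin 3 → ZMod (2 * S + 1),
    (r.ρ (gaugeTransform h U (Fin.cons 0 y, j.succ)) * X).trace.re with hT
  have hZ : zeroModePair r S j U h X = -T := by
    rw [hT, sum_re_trace_mul_eq_neg_zeroModePair r S j U h hskew, neg_neg]
  have hper := perMin_eq_of_isCoulMin r S U h hmin
  have hquad : ∀ t : ℝ,
      0 ≤ (2 * S + 1 : ℝ) ^ 3 * froSq X / 2 * (t * t) + (-T) * t + twistGap r S j U := fun t => by
    have h1 := twistMin_le_boosted r S j U h hX t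
    have h2 := boostedCoulombF_exp_le r S j U h hXu t
    have h3 : twistGap r S j U = coulombF r S U h - twistMin r S j U := by
      unfold twistGap; rw [hper]
    rw [h3]
    nlinarith [h1, h2]
  have hdisc := discrim_le_zero hquad
  rw [discrim] at hdisc
  rw [hZ]
  nlinarith [hdisc]

end Summit.QuantumFields.YangMills.Cruxes.CovarianceBound.TwistStiffness

end
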